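import Summits.PneNP.PneNP.Theses.SymmetryBudget
import Summits.PneNP.PneNP.Theorems.NPNotSubsetPPoly
import Summits.PneNP.PneNP.Theorems.SymmetryBudgetHamCompiles
import Summits.PneNP.PneNP.Theorems.WindowHam.Negative.WindowHamFalseIff
import Summits.PneNP.PneNP.Theorems.WindowHam.Negative.InvariantDNFHam
import Literature.Computability.Complexity.HamMatrixCircuits
import Literature.Computability.Complexity.CircuitClassesUniformProofs
import Literature.Computability.Complexity.ClayProblemConsequences
import Literature.Computability.Complexity.CookBridges

/-!
# `WindowHam` ⟺ `NP ⊄ P/poly` — the crux of route `SymmetryBudget` is route `Circuit`'s crux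

Crux `stmt-PneNP-2143` (`Summit.PneNP.PneNP.Theses.SymmetryBudget.WindowHam`): for every polynomial
`p`, infinitely often no `Bud(m,⌊log₂ m⌋)`-symmetric threshold circuit with `≤ p m` gates computes
Hamiltonicity of the graph of an `m × m` Boolean matrix.

This file lands, under `Theorems/`, the calibration reached by the crux chain (strategist census
`Cruxes/WindowHam/STRATEGY-CENSUS.md`, disprover findings F3/F10–F12, triage r1/r2) as kernel-checked
theorems over LANDED modules only:

* `windowHam_of_npNotSubsetPPoly` — `NP ⊄ P/poly → WindowHam`: symmetric ⊆ general at budget `0`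
  (`hasSymCircuit_budget_zero_iff`, antitone budget `hasSymCircuit_of_budget_le`), patching of small `m`
  (`hasSym_ham_eventually_iff_forall`), and the hardness bridge
  `HamMatrix.np_subset_PPoly_iff_polySize_tcBasis` (HAM has poly-size matrix threshold circuits at
  every `m` iff `NP ⊆ P/poly`; Karp-completeness of `HAMCIRCUIT`, proved in tree).
* `npNotSubsetPPoly_of_windowHam` — `WindowHam → NP ⊄ P/poly`: the P/poly form of the PROVED sibling
  crux `HamCompiles` (`HamCompilesKC.hamCompilesPPoly`, line kotzig-cutspan: `NP ⊆ P/poly` gives ONE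
  polynomial and window-symmetric threshold circuits for `HAM_m` at EVERY `m`), which `WindowHam`
  forbids at that polynomial.
* `windowHam_iff_npNotSubsetPPoly : WindowHam ↔ NPNotSubsetPPoly` — the conjecture leaf
  `Summit.PneNP.PneNP.NPNotSubsetPPoly` (`¬ (NP ⊆ P/poly)`), which is `rfl`-equal to route Circuit's
  crux `Summit.PneNP.PneNP.Theses.Circuit.CircuitThesis` (stmt-PneNP-10624); spelled out literally as
  `windowHam_iff_not_np_subset_PPoly`.
* `windowHam_iff_hamHardGeneral` — the symmetry budget `⌊log₂ m⌋` buys no logical room: the crux is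
  equivalent to its own budget-`0` strengthening, the plain threshold-circuit lower bound for HAM in
  the matrix encoding; `windowHam_iff_not_polySize` is the "one polynomial, every `m`" form.
* `pneNP_of_windowHam` — the summit follows from this crux ALONE (route `closes` with the landed
  `HamCompiles_proof`): route `SymmetryBudget` has degenerated onto route `Circuit`.

Consequence for the item: `stmt-PneNP-2143` is provably the same obligation as `stmt-PneNP-10624`
(`NP ⊄ P/poly`, Karp–Lipton's hypothesis negated, which implies the summit `PneNP` and is believed
strictly stronger). Nothing here asserts the crux; the `→ WindowHam` directions are conditional on
the registered open statement `NPNotSubsetPPoly`.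
-/

-- `Summit.PneNP.PneNP.…` duplicates `PneNP` BY DESIGN (single-problem summit, D-0017).
set_option linter.dupNamespace false

namespace Summit.PneNP.PneNP.Theorems

open Literature.Computability.Complexity Filter
open Summit.PneNP.PneNP.Theses.SymmetryBudget (WindowHam HamCompiles)
open Summit.PneNP.PneNP.Theorems.WindowHam.Negative

/-! ## Budget `0`: the crux versus the plain threshold-circuit lower bound for HAM -/

/-- **Dropping the symmetry budget only strengthens**: if, for every polynomial, infinitely often NO
threshold circuit at all (no symmetry requirement) of that size computes `HAM_m`, then `WindowHam`.
(Budget `0` = only the identity acts, `hasSymCircuit_budget_zero_iff`; antitone budget.) -/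
theorem windowHam_of_hamHardGeneral
    (h : ∀ p : Polynomial ℕ, ∃ᶠ m in atTop, ¬ ∃ C : Circuit (Fin m × Fin m),
      C.IsOver tcBasis ∧ C.size ≤ p.eval m ∧ C.Computes (HamMatrix.hamFn m)) :
    WindowHam := by
  intro p
  refine (h p).mono fun m hm hsym => hm ?_
  exact hasSymCircuit_budget_zero_iff.1 (hasSymCircuit_of_budget_le (Nat.zero_le _) hsym)

/-- **`¬ PolySize → WindowHam`**: if HAM does not have polynomial-size matrix threshold circuits at
every `m` (one polynomial), the crux holds — a refutation of the crux, with symmetry dropped and the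
finitely many small `m` patched by the DNF (`hasSym_ham_eventually_iff_forall`), IS such a family. -/
theorem windowHam_of_not_polySize (h : ¬ HamMatrix.PolySize tcBasis) : WindowHam := by
  by_contra hW
  apply h
  obtain ⟨p, N, hN⟩ := not_windowHam_iff.1 hW
  have hev : ∃ p : Polynomial ℕ, ∃ N : ℕ, ∀ m ≥ N,
      HasSymCircuit tcBasis (pointStabiliserBudget m 0) (p.eval m) (HamMatrix.hamFn m) :=
    ⟨p, N, fun m hm => hasSymCircuit_of_budget_le (Nat.zero_le _) (hN m hm)⟩
  obtain ⟨q, hq⟩ := (hasSym_ham_eventually_iff_forall (fun _ => 0)).1 hev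
  exact ⟨q, fun m => hasSymCircuit_budget_zero_iff.1 (hq m)⟩

/-- **`NP ⊄ P/poly → WindowHam`** (Dec1 of the census; conditional on the registered open statement
`NPNotSubsetPPoly`, route Circuit's crux): by the landed bridge
`HamMatrix.np_subset_PPoly_iff_polySize_tcBasis`, `NP ⊄ P/poly` says HAM has no polynomial-size
matrix threshold circuits, and general hardness implies window-symmetric hardness. -/
theorem windowHam_of_npNotSubsetPPoly (h : NPNotSubsetPPoly) : WindowHam :=
  windowHam_of_not_polySize fun hP => h (HamMatrix.np_subset_PPoly_iff_polySize_tcBasis.2 hP)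

/-! ## The converse: the proved sibling crux `HamCompiles` in P/poly form -/

/-- **`WindowHam → NP ⊄ P/poly`**: were `NP ⊆ P/poly`, the equivariant compilation of the PROVED
sibling crux (`HamCompilesKC.hamCompilesPPoly`, line kotzig-cutspan: Kotzig/cut-span interface bits
as `Bud(m,⌊log₂ m⌋)`-symmetric poly-size threshold circuits, bolted under a poly-size circuit for
the NP residue language) would give ONE polynomial `p` with window-symmetric circuits for `HAM_m`
at EVERY `m`, contradicting `WindowHam` at `p`. -/
theorem npNotSubsetPPoly_of_windowHam (hW : WindowHam) : NPNotSubsetPPoly := by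
  intro hNP
  obtain ⟨p, hp⟩ := HamCompilesKC.hamCompilesPPoly hNP
  obtain ⟨m, hm⟩ := (hW p).exists
  exact hm (hp m)

/-- **`WindowHam ↔ NP ⊄ P/poly`.** The crux of route `SymmetryBudget` (stmt-PneNP-2143) is
EQUIVALENT to the conjecture leaf `NPNotSubsetPPoly` = route Circuit's crux `CircuitThesis`
(stmt-PneNP-10624, `rfl`-equal statement): every proof strategy for the one is a proof strategy for
the other, and the symmetric costume carries no logical content for HAM at budget `⌊log₂ m⌋`. -/
theorem windowHam_iff_npNotSubsetPPoly : WindowHam ↔ NPNotSubsetPPoly :=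
  ⟨npNotSubsetPPoly_of_windowHam, windowHam_of_npNotSubsetPPoly⟩

/-- The same with the conjecture leaf unfolded — literally the body of
`Summit.PneNP.PneNP.Theses.Circuit.CircuitThesis` (stmt-PneNP-10624). -/
theorem windowHam_iff_not_np_subset_PPoly : WindowHam ↔ ¬ (Nondeterministic.NP ⊆ PPoly) :=
  windowHam_iff_npNotSubsetPPoly

/-- **A refutation of the crux is exactly Karp–Lipton's hypothesis**: `¬ WindowHam ↔ NP ⊆ P/poly`. -/
theorem not_windowHam_iff_np_subset_PPoly : ¬ WindowHam ↔ Nondeterministic.NP ⊆ PPoly := by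
  rw [windowHam_iff_not_np_subset_PPoly, not_not]

/-- **"One polynomial, every `m`" form**: the crux holds iff HAM does NOT have polynomial-size
matrix threshold circuits (`HamMatrix.PolySize tcBasis`, no symmetry at all). -/
theorem windowHam_iff_not_polySize : WindowHam ↔ ¬ HamMatrix.PolySize tcBasis := by
  rw [windowHam_iff_not_np_subset_PPoly, HamMatrix.np_subset_PPoly_iff_polySize_tcBasis]

/-- **The budget is inert**: `WindowHam` is equivalent to its own budget-`0` strengthening, the plain
(non-symmetric) threshold-circuit lower bound for HAM in the matrix encoding — "for every polynomial,
infinitely often no threshold circuit of that size computes `HAM_m`". -/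
theorem windowHam_iff_hamHardGeneral :
    WindowHam ↔ ∀ p : Polynomial ℕ, ∃ᶠ m in atTop, ¬ ∃ C : Circuit (Fin m × Fin m),
      C.IsOver tcBasis ∧ C.size ≤ p.eval m ∧ C.Computes (HamMatrix.hamFn m) := by
  refine ⟨fun hW p => ?_, windowHam_of_hamHardGeneral⟩
  by_contra hfr
  obtain ⟨N, hN⟩ := Filter.eventually_atTop.1 (Filter.not_frequently.1 hfr)
  refine windowHam_iff_not_polySize.1 hW ?_
  have hev : ∃ p : Polynomial ℕ, ∃ N : ℕ, ∀ m ≥ N,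
      HasSymCircuit tcBasis (pointStabiliserBudget m 0) (p.eval m) (HamMatrix.hamFn m) :=
    ⟨p, N, fun m hm => hasSymCircuit_budget_zero_iff.2 (not_not.1 (hN m hm))⟩
  obtain ⟨q, hq⟩ := (hasSym_ham_eventually_iff_forall (fun _ => 0)).1 hev
  exact ⟨q, fun m => hasSymCircuit_budget_zero_iff.1 (hq m)⟩

/-! ## The route degenerates onto route `Circuit` -/

/-- **The summit from this crux alone**: with the sibling crux `HamCompiles` PROVED
(`HamCompiles_proof`), the route's deciding theorem `closes : WindowHam → HamCompiles → PneNP` needs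
only `WindowHam` — equivalently (`windowHam_iff_npNotSubsetPPoly`) only `NP ⊄ P/poly`. -/
theorem pneNP_of_windowHam (h : WindowHam) : _root_.PneNP :=
  -- route SymmetryBudget's `closes` is no longer in the route file; the same conclusion via the
  -- conjecture leaf: `WindowHam ↔ NP ⊄ P/poly` (this file), `P ⊆ P/poly` (`P_subset_PPoly_holds`),
  -- and Cook's shape of the summit (`pneNP_shape_of_P_ne_NP`)
  Literature.Computability.Complexity.pneNP_shape_of_P_ne_NP
    (Literature.Computability.Complexity.NPNotSubsetPPoly.P_ne_NP (windowHam_iff_npNotSubsetPPoly.1 h)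
      Literature.Computability.Complexity.P_subset_PPoly_holds)

end Summit.PneNP.PneNP.Theorems
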